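/-
Copyright (c) 2026 the pub-hodgecm2 formalisation cell (harness21).  New file.
Origin: seat `prover-pub-hodgecm2-item6-p2-g8-0` (unit pub-hodgecm2-item6-p2, TRANSPOSITION item (vi) extra prover p2, gen 8;
§1b rank-one branch added by gen 9 `prover-pub-hodgecm2-item6-p2-g9-0`), 2026-08-21 — the (J3) PLACEMENT JUNCTION on the package record the ported head consumes (own-b01 J3, INBOX l.4951; b01-idea-1
IDEA-1w §4.4 (B1)–(B8); coordinator rulings 19:05:27Z VENUE / 19:13:07Z FULL PORT).  KERNEL only: theorems, no `def`, no cited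
record beyond the displayed binders; count-neutral; HC_CM is NOT proved; nothing here is a claim of the manuscripts under adjudication.
T5: consistency check by pub-hodgecm2-t5-consist-1 2026-08-21T19:36:06Z — Item6PlacementJunction.part.lean md5 ee4e8096c67d — NO
CONTRADICTION DERIVED (HOME/T5-LEDGER.md l.37) + T5 CARRY 2026-08-21T19:51:28Z — md5 7ca78304d0e0 (l.49; = the filed body below: KEPT namespace
`HodgeCM.Literature.Theta`, `Thm418Realised` inlined, §2 consuming pin-3's `Thm418Data.resW_mem_span_of_fixed_of_thm418AsPrinted_act`);
T5 DELTA (v2 = v1 + §1b `block_le_range_of_rank_hom_le_one` / `block_eq_range_of_rank_hom_le_one` / `thm418Combined_of_realised_rankOne` /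
`nontrivial_Ω_of_irreducible`, hypothesis binders `hnv`, `hmult` replacing `hirr h413 h2 hμ` on that branch): requested from t5-consist-1 (HOME/INBOX, gen 9).
-/
import Summits.HodgeConjecture.HodgeCM.Literature.AlbaneseUnitaryShimuraModules
import Literature.NumberTheory.Automorphic.Liu2021.Thm418CombinedReading
import Literature.RepresentationTheory.Semisimple.MultiplicityFreeIsotypic
import Literature.RepresentationTheory.Liu2021.AlbaneseBlockMultiplicityOne
import Literature.NumberTheory.Automorphic.Liu2021.Thm418AsPrinted
import HarnessLib

set_option autoImplicit false

/-!
# The PLACEMENT junction (J3): Liu's combined reading r8 `Thm418Combined` from Thm. 4.18 REALISED inside `H¹_{B,τ'}(A_∞, ℂ)`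

Over the package's real-carrier record `LiuAlbaneseModuleDatum G Kof` ([Liu21] §4.1–4.2 automorphic side as `ℂ[G]`-modules;
package `HodgeCM/Literature/AlbaneseUnitaryShimuraModules.lean`, tree port `Summits/HodgeConjecture/HodgeCM/Literature/AlbaneseUnitaryShimuraModules.lean` (port_pkg, namespace KEPT))
the combined reading r8 `T.Thm418Combined res cmCl` — the ONE Liu-side binder `h418 : (liuDictionaryPin …).Thm418C` of the package
head `periodThmF_picardCM_of_GRU_thm418C` (`Model/PeriodThmFFace.lean`:176, `Thm418C := T.Thm418Combined T.res T.cmClasses`,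
`Model/LiuDictionary.lean`:210) — is DERIVED from the numbered statements it was read out of, split as in b01-idea-1's
IDEA-1w §4.4 (B2)–(B8):

* (B2) `T.Irreducible` [Def. 4.11], (B3) `T.Prop413` [Prop. 4.13, module-iso form], (B4) `T.Thm418_2` [Thm. 4.18 (2)] +
  `T.MuSeparated` [Lem. D.1 (3) + glue] — multiplicity one of the `μ`-admissible constituents in `H`;
* (B1)+(B5) REALISATION: an injective `ℂ[G]`-linear `g : ⨁_a ω(μ,a) → H` — Thm. 4.18 main statement `ℂ ⊗_{M_μ} Ω(μ) ≃ ⨁_a ω(μ,a)`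
  composed with the injective equivariant map (4.3) `f ⊗ z ↦ z · f^*α` of its proof (`FJcycle.tex` l. 2250);
* (B6)+(B7)+(B8) GENERATION: for `K ≤ K₀` every `K`-fixed vector of the realised module restricts on `P_K` into the span of the CM
  classes — Thm. 4.18 (1) `Ω(μ)^K ≃ Hom_E(A_K, A_μ)_ℚ`, the commutation of `K`-fixed vectors with `⊗_{M_μ} ℂ`
  (tree `Literature.LinearAlgebra.BaseChange.FixedPointsBaseChange`, p287946), and Lem. 2.4 (1) + Betti functoriality.

KERNEL: `block μ ≤ range g` is multiplicity-free isotypic placement (tree `Literature.RepresentationTheory.Semisimple.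
MultiplicityFreeIsotypic.range_eq_iSup_iSup_range_of_injective`, p287651, [Bourbaki A VIII §4 n°6–7]); the rest is bookkeeping.
RANK-ONE BRANCH (§1b; b01-idea-1 IDEA-1x §G2 / IDEA-1z «prefer G2 rank-one», tr-prover-6's M1 record p302689): the SAME
junction with (B2)–(B4) replaced by the ONE printed sentence [Prop. 4.13, proof l. 2145] «multiplicity one», typed
`Module.rank ℂ (ω(μ,a) →ₗ[ℂ[G]] H) ≤ 1`, plus `ω(μ,a) ≠ 0` [Def. 4.11] — kernel Step 1 = tree `Literature.RepresentationTheory.Liu2021.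
iSup_iSup_range_le_range_of_rank_hom_le_one` (`AlbaneseBlockMultiplicityOne.lean`); `thm418Combined_of_realised_rankOne`.
Nothing here constructs Liu's objects, discharges a pin, or touches the E term; HC_CM is NOT proved.
-/

noncomputable section

open scoped DirectSum

namespace HodgeCM.Literature.Theta

namespace LiuAlbaneseModuleDatum

universe u v w

variable {G : Type u} [Group G] {Lvl : Type v} {Kof : Lvl → Subgroup G} {T : LiuAlbaneseModuleDatum G Kof}

/-- Irreducibility of every `ω(μ,ε,χ)` [Def. 4.11] as an instance family on the triples. [cite: Liu2021, Def. 4.11] -/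
theorem isSimpleModule_Ωt (hirr : T.Irreducible) (t : T.Triple) : IsSimpleModule (MonoidAlgebra ℂ G) (T.Ωt t) :=
  hirr t.1 t.2

/-- **Multiplicity-one PLACEMENT.** If `H ≅ ⨁_t ω(t)` [Prop. 4.13] with the `ω(t)` irreducible [Def. 4.11] and pairwise
non-isomorphic [Thm. 4.18 (2) + `MuSeparated`], then every `ℂ[G]`-map `ω(μ,a) → H` lands inside the range of ANY injective
`ℂ[G]`-linear realisation `g : ⨁_a ω(μ,a) → H` of the `μ`-block; i.e. `block μ ≤ range g`.
[cite: BourbakiAlgebreVIII2012, §4 n°6 Prop. 4 d) Cor.] -/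
theorem block_le_range_of_injective (hirr : T.Irreducible) (h413 : T.Prop413) (h2 : T.Thm418_2) (hμ : T.MuSeparated)
    {μ : T.Char} {g : (⨁ a : T.Adm μ, T.Ω μ a) →ₗ[MonoidAlgebra ℂ G] T.H} (hg : Function.Injective g) :
    T.block μ ≤ (LinearMap.range g).restrictScalars ℂ := by
  haveI : ∀ t : T.Triple, IsSimpleModule (MonoidAlgebra ℂ G) (T.Ωt t) := isSimpleModule_Ωt hirr
  have hS : ∀ t t' : T.Triple, Nonempty (T.Ωt t ≃ₗ[MonoidAlgebra ℂ G] T.Ωt t') → t = t' :=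
    triple_eq_of_equiv h2 hμ
  have hP : Nonempty ((⨁ a : T.Adm μ, T.Ω μ a) ≃ₗ[MonoidAlgebra ℂ G] ⨁ a : T.Adm μ, T.Ωt ⟨μ, a⟩) :=
    ⟨LinearEquiv.refl _ _⟩
  have hrange := Literature.RepresentationTheory.Semisimple.range_eq_iSup_iSup_range_of_injective
    (S := T.Ωt) hS h413 (fun a : T.Adm μ => (⟨μ, a⟩ : T.Triple)) hP hg
  refine block_le fun a ψ => ?_
  have hψ : LinearMap.range ψ ≤ LinearMap.range g := by
    rw [hrange]
    exact le_iSup_of_le a (le_iSup (fun ψ : T.Ωt ⟨μ, a⟩ →ₗ[MonoidAlgebra ℂ G] T.H => LinearMap.range ψ) ψ)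
  exact fun x hx => hψ hx

/-- Conversely the range of any `ℂ[G]`-linear `g : ⨁_a ω(μ,a) → H` lies in `block μ` (no hypothesis). [folklore] -/
theorem range_le_block {μ : T.Char} (g : (⨁ a : T.Adm μ, T.Ω μ a) →ₗ[MonoidAlgebra ℂ G] T.H) :
    (LinearMap.range g).restrictScalars ℂ ≤ T.block μ := by
  classical
  rintro x ⟨y, rfl⟩
  induction y using DirectSum.induction_on with
  | zero => rw [map_zero]; exact Submodule.zero_mem _
  | of a m =>
    have h := range_le_oscImage (D := T) ⟨μ, a⟩ (g ∘ₗ DirectSum.lof (MonoidAlgebra ℂ G) (T.Adm μ) (fun a => T.Ω μ a) a)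
    exact oscImage_le_block (D := T) ⟨μ, a⟩ (h ⟨m, rfl⟩)
  | add y z hy hz => rw [map_add]; exact Submodule.add_mem _ hy hz

/-- With multiplicity one, the `μ`-block IS the range of any injective realisation. [folklore] -/
theorem block_eq_range_of_injective (hirr : T.Irreducible) (h413 : T.Prop413) (h2 : T.Thm418_2) (hμ : T.MuSeparated)
    {μ : T.Char} {g : (⨁ a : T.Adm μ, T.Ω μ a) →ₗ[MonoidAlgebra ℂ G] T.H} (hg : Function.Injective g) :
    T.block μ = (LinearMap.range g).restrictScalars ℂ :=
  le_antisymm (block_le_range_of_injective hirr h413 h2 hμ hg) (range_le_block g)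

/-- **THE PLACEMENT JUNCTION.**  Def. 4.11 + Prop. 4.13 + Thm. 4.18 (2) + `MuSeparated` + «Thm. 4.18 REALISED at every `μ` with
`τ' ∈ Φ_μ`» ⟹ the combined reading r8 `Thm418Combined res cmCl`.  «Thm. 4.18 realised at `μ`» (the hypothesis `hreal`) is the shape in
which Liu PROVES his main statement (`FJcycle.tex` l. 2247–2266): an injective `ℂ[G]`-linear `g` from the abstract direct sum
`⨁_{(ε,χ) adm} ω(μ,ε,χ)` (≅ `Ω(μ) ⊗_{M_μ} ℂ`, main statement) into `H = H¹_{B,τ'}(A_∞, ℂ)` (the map (4.3)), together with the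
GENERATION property of its `K`-fixed vectors for `K` small [Thm. 4.18 (1) + Lem. 2.4 (1) + `K`-fixed/`⊗` commutation]: they restrict
on `P_K` into the span of the CM classes — supplied from Thm. 4.18 AS PRINTED by `thm418Realised_of_asPrinted` (§2).  KERNEL: a `K`-fixed `x ∈ block μ` lies in `range g`
(`block_le_range_of_injective`), `x = g y`, and the generation clause applies to `y`. [cite: Liu2021, Thm. 4.18, Thm. 4.18 (1), (4.3)] -/
theorem thm418Combined_of_realised [Preorder Lvl] {W : Lvl → Type w} [∀ K, AddCommGroup (W K)] [∀ K, Module ℂ (W K)]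
    {res : ∀ K : Lvl, T.H →ₗ[ℂ] W K} {cmCl : ∀ K : Lvl, T.Char → Set (W K)}
    (hirr : T.Irreducible) (h413 : T.Prop413) (h2 : T.Thm418_2) (hμ : T.MuSeparated)
    (hreal : ∀ μ : T.Char, T.PhiMu μ →
      (∃ g : (⨁ a : T.Adm μ, T.Ω μ a) →ₗ[MonoidAlgebra ℂ G] T.H, Function.Injective g ∧
        ∃ K₀ : Lvl, ∀ K ≤ K₀, ∀ y, g y ∈ fixedBy (Kof K) T.H → res K (g y) ∈ Submodule.span ℂ (cmCl K μ))) :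
    T.Thm418Combined res cmCl := by
  intro μ hΦ
  obtain ⟨g, hg, K₀, hK⟩ := hreal μ hΦ
  refine ⟨K₀, fun K hKle x hx hfix => ?_⟩
  obtain ⟨y, rfl⟩ : x ∈ (LinearMap.range g).restrictScalars ℂ := block_le_range_of_injective hirr h413 h2 hμ hg hx
  exact hK K hKle y hfix

/-! ### §1b. The RANK-ONE branch (recommended, b01-idea-1 IDEA-1x/1z: «prefer G2 rank-one»): Step 1 from ONE printed sentence

[Liu2021, proof of Prop. 4.13, last sentence, `FJcycle.tex` l. 2145], AS PRINTED: "… the dimension of `H¹_{B,τ'}(A_∞,ℂ)[ω(μ,ε,χ)]`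
is `1`."  Typed as the rank bound `Module.rank ℂ (ω(μ,a) →ₗ[ℂ[G]] H) ≤ 1` (tree `Literature.RepresentationTheory.Liu2021.
AlbaneseBlockMultiplicityOne`, kernel Step 1 `iSup_iSup_range_le_range_of_rank_hom_le_one`; at the pin it is tr-prover-6's M1 record
`Prop413Data.MultOneAsPrinted.rank_linearMap_asModule_le_one`, p302689).  On this branch NO decomposition of `H` (Prop. 4.13's display),
NO Thm. 4.18 (2) and NO `MuSeparated` is used — the package records (B2)–(B4) drop out of the junction; only `ω(μ,a) ≠ 0` (Def. 4.11,
"irreducible", in particular non-zero) remains. -/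

/-- **Multiplicity-one PLACEMENT, rank-one branch.**  If every multiplicity space `Hom_{ℂ[G]}(ω(μ,a), H)` has `ℂ`-rank `≤ 1`
[Prop. 4.13, proof l. 2145] and every `ω(μ,a)` is non-zero [Def. 4.11], then `block μ ≤ range g` for ANY injective `ℂ[G]`-linear
realisation `g : ⨁_a ω(μ,a) → H` of the `μ`-block (kernel: tree `iSup_iSup_range_le_range_of_rank_hom_le_one`; `block μ` and
`oscImage` unfold to its double `iSup`). [cite: Liu2021, Prop. 4.13, proof l. 2145; Def. 4.11] -/
theorem block_le_range_of_rank_hom_le_one {μ : T.Char} (hnv : ∀ a : T.Adm μ, Nontrivial (T.Ω μ a))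
    (hmult : ∀ a : T.Adm μ, Module.rank ℂ (T.Ω μ a →ₗ[MonoidAlgebra ℂ G] T.H) ≤ 1)
    {g : (⨁ a : T.Adm μ, T.Ω μ a) →ₗ[MonoidAlgebra ℂ G] T.H} (hg : Function.Injective g) :
    T.block μ ≤ (LinearMap.range g).restrictScalars ℂ := by
  classical
  haveI : ∀ a : T.Adm μ, Nontrivial (T.Ω μ a) := hnv
  have h := Literature.RepresentationTheory.Liu2021.iSup_iSup_range_le_range_of_rank_hom_le_one (k := ℂ)
    (fun a : T.Adm μ => T.Ω μ a) hmult g hg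
  refine block_le fun a ψ x hx => h ?_
  exact Submodule.mem_iSup_of_mem a (Submodule.mem_iSup_of_mem ψ hx)

/-- With multiplicity one (rank form), the `μ`-block IS the range of any injective realisation. [folklore] -/
theorem block_eq_range_of_rank_hom_le_one {μ : T.Char} (hnv : ∀ a : T.Adm μ, Nontrivial (T.Ω μ a))
    (hmult : ∀ a : T.Adm μ, Module.rank ℂ (T.Ω μ a →ₗ[MonoidAlgebra ℂ G] T.H) ≤ 1)
    {g : (⨁ a : T.Adm μ, T.Ω μ a) →ₗ[MonoidAlgebra ℂ G] T.H} (hg : Function.Injective g) :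
    T.block μ = (LinearMap.range g).restrictScalars ℂ :=
  le_antisymm (block_le_range_of_rank_hom_le_one hnv hmult hg) (range_le_block g)

/-- **THE PLACEMENT JUNCTION, rank-one branch.**  Multiplicity one as printed [Prop. 4.13, proof l. 2145: `rank ≤ 1`] + `ω(μ,a) ≠ 0`
[Def. 4.11] + «Thm. 4.18 REALISED at every `μ` with `τ' ∈ Φ_μ`» (the hypothesis `hreal`, supplied from Thm. 4.18 AS PRINTED by
`thm418Realised_of_asPrinted`, §2) ⟹ the combined reading r8 `Thm418Combined res cmCl` — WITHOUT Prop. 4.13's decomposition,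
Thm. 4.18 (2) or `MuSeparated`.  KERNEL: a `K`-fixed `x ∈ block μ` lies in `range g` (`block_le_range_of_rank_hom_le_one`), `x = g y`,
and the generation clause applies to `y`. [cite: Liu2021, Prop. 4.13, proof l. 2145; Def. 4.11; Thm. 4.18, Thm. 4.18 (1), (4.3)] -/
theorem thm418Combined_of_realised_rankOne [Preorder Lvl] {W : Lvl → Type w} [∀ K, AddCommGroup (W K)] [∀ K, Module ℂ (W K)]
    {res : ∀ K : Lvl, T.H →ₗ[ℂ] W K} {cmCl : ∀ K : Lvl, T.Char → Set (W K)}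
    (hnv : ∀ (μ : T.Char) (a : T.Adm μ), Nontrivial (T.Ω μ a))
    (hmult : ∀ (μ : T.Char) (a : T.Adm μ), Module.rank ℂ (T.Ω μ a →ₗ[MonoidAlgebra ℂ G] T.H) ≤ 1)
    (hreal : ∀ μ : T.Char, T.PhiMu μ →
      (∃ g : (⨁ a : T.Adm μ, T.Ω μ a) →ₗ[MonoidAlgebra ℂ G] T.H, Function.Injective g ∧
        ∃ K₀ : Lvl, ∀ K ≤ K₀, ∀ y, g y ∈ fixedBy (Kof K) T.H → res K (g y) ∈ Submodule.span ℂ (cmCl K μ))) :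
    T.Thm418Combined res cmCl := by
  intro μ hΦ
  obtain ⟨g, hg, K₀, hK⟩ := hreal μ hΦ
  refine ⟨K₀, fun K hKle x hx hfix => ?_⟩
  obtain ⟨y, rfl⟩ : x ∈ (LinearMap.range g).restrictScalars ℂ :=
    block_le_range_of_rank_hom_le_one (hnv μ) (hmult μ) hg hx
  exact hK K hKle y hfix

/-- **Transport of multiplicity one along the summand identification** (row (Ω) of the object match): if the record's
`ω(μ,a)` are `ℂ[G]`-isomorphic to members `M (σ a)` of a family whose multiplicity spaces in `H` have `ℂ`-rank `≤ 1` (at the pin: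
`M i := (D.rhoAt i).asModule` for Liu's as-printed datum `D`, the bound being tr-prover-6's M1 record
`Prop413Data.MultOneAsPrinted.rank_linearMap_asModule_le_one`, p302689), then so do the record's (`LinearEquiv.congrLeft`).
[cite: Liu2021, Prop. 4.13, proof l. 2145] -/
theorem rank_hom_le_one_of_equiv {μ : T.Char} {ι : Type*} {M : ι → Type*} [∀ i, AddCommGroup (M i)]
    [∀ i, Module (MonoidAlgebra ℂ G) (M i)] (σ : T.Adm μ → ι) (e : ∀ a, T.Ω μ a ≃ₗ[MonoidAlgebra ℂ G] M (σ a))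
    (hM : ∀ i, Module.rank ℂ (M i →ₗ[MonoidAlgebra ℂ G] T.H) ≤ 1) (a : T.Adm μ) :
    Module.rank ℂ (T.Ω μ a →ₗ[MonoidAlgebra ℂ G] T.H) ≤ 1 := by
  -- `f : Hom(ω(μ,a), H) ≃ Hom(M (σ a), H)` over `ℂ`; transport a spanning vector (universe-polymorphic, no `Cardinal.lift`)
  let f := LinearEquiv.congrLeft T.H ℂ (e a)
  obtain ⟨v₀, hv₀⟩ := rank_le_one_iff.mp (hM (σ a))
  refine rank_le_one_iff.mpr ⟨f.symm v₀, fun v => ?_⟩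
  obtain ⟨r, hr⟩ := hv₀ (f v)
  exact ⟨r, by rw [← LinearEquiv.map_smul, hr, LinearEquiv.symm_apply_apply]⟩

/-- Irreducible modules are non-zero: the decomposition branch's (B2) implies the rank-one branch's `hnv`. [folklore] -/
theorem nontrivial_Ω_of_irreducible (hirr : T.Irreducible) (μ : T.Char) (a : T.Adm μ) : Nontrivial (T.Ω μ a) :=
  haveI := hirr μ a
  IsSimpleModule.nontrivial (MonoidAlgebra ℂ G) (T.Ω μ a)


/-! ## §2. The adapter: «Thm. 4.18 realised» from [Liu21, Thm. 4.18] AS PRINTED + the realisation map (4.3) + the CM side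

Per character `μ`: Liu's as-printed datum `D : Thm418Data F E` (tree `Liu2021.Thm418AsPrinted`, p277833) supplies the abstract
isomorphism `Φ : ℂ ⊗_{M_μ} Ω(μ) ≃ ⨁_{(ε,χ)} ω(μ,ε,χ)` (main) intertwining the actions; the record `T` is taken over Liu's group `D.G`
(the instantiator builds both from the same `G`, so `D.G` is its `G` definitionally); the remaining inputs are the (B1) carrier join
`ψ` (T's `μ`-pieces ARE Liu's summands, `G`-equivariantly), the (B5) realisation `J` = (4.3) «`f ⊗ z ↦ z · f^*α`, which is
`ℂ[G]`-linear» and injective (`FJcycle.tex` l. 2250–2266), the level dictionary (`Kof` monotone, open-compact valued, cofinal),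
and (B8) `hpin`: the class `f^*α`, `f ∈ Hom_E(A_K, A_μ)_ℚ`, restricted to `P_K`, IS one of the CM classes (Lem. 2.4 (1) + Betti
functoriality + the contract on `adm`).  The GENERATION step — item (1) `Ω(μ)^K = Hom_E(A_K, A_μ)_ℚ` + the `K`-fixed/`⊗_{M_μ} ℂ`
commutation [Milne2017 Cor. 4.34] — is the tree's `Thm418Data.resW_mem_span_of_fixed_of_thm418AsPrinted_act` (pin-3,
`Liu2021/Thm418CombinedReading.lean`, p301605 + sequel), consumed BY NAME with `act g x := MonoidAlgebra.of ℂ G g • x`. -/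

section Adapter

open Literature.NumberTheory.Automorphic.Liu2021 NumberField
open scoped TensorProduct

variable {F E : Type} [Field F] [NumberField F] [IsTotallyReal F] [Field E] [NumberField E] [Algebra F E]
  [IsTotallyComplex E] [Algebra.IsQuadraticExtension F E]

/-- **«Thm. 4.18 realised at `μ`» from Thm. 4.18 AS PRINTED** — the hypothesis `hreal` of `thm418Combined_of_realised` at one `μ`,
for Liu's datum `D` with `Thm418AsPrinted D`, a record `T` over `D.G`, a character `μ` of `T` whose pieces are Liu's summands
(`ψ`, `G`-equivariant), an injective `G`-equivariant realisation `J : ℂ ⊗_{M_μ} Ω(μ) → H` (the map (4.3)), a monotone cofinal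
family of open compact levels `Kof`, and an object `D_μ ∈ 𝒜(μ)` whose classes `f^*α` are CM classes.  KERNEL: `g := J ∘ Φ⁻¹ ∘ ψ`
is `ℂ[G]`-linear (`MonoidAlgebra.equivariantOfLinearOfComm`) and injective; the generation clause for `g y = J (Φ⁻¹ (ψ y))` is
`resW_mem_span_of_fixed_of_thm418AsPrinted_act` at `act g x := of g • x`. [cite: Liu2021, Thm. 4.18, Thm. 4.18 (1), (4.3)] -/
theorem thm418Realised_of_asPrinted (D : Thm418Data F E) [Preorder Lvl] {Kof : Lvl → Subgroup D.G}
    {T : LiuAlbaneseModuleDatum D.G Kof}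
    {W : Lvl → Type w} [∀ K, AddCommGroup (W K)] [∀ K, Module ℂ (W K)]
    {res : ∀ K : Lvl, T.H →ₗ[ℂ] W K} {cmCl : ∀ K : Lvl, T.Char → Set (W K)} {μ : T.Char}
    (hLiu : Thm418AsPrinted D)
    (hmono : ∀ ⦃K K' : Lvl⦄, K ≤ K' → Kof K ≤ Kof K') (hoc : ∀ K : Lvl, IsOpenCompact (Kof K))
    (hcof : ∀ K₀ : Subgroup D.G, IsOpenCompact K₀ → ∃ K₁ : Lvl, Kof K₁ ≤ K₀)
    (ψ : (⨁ a : T.Adm μ, T.Ω μ a) ≃ₗ[ℂ] ⨁ i : D.AdmIndex, D.omegaAt i)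
    (hψ : ∀ (g : D.G) (y : ⨁ a : T.Adm μ, T.Ω μ a) (i : D.AdmIndex),
      ψ (MonoidAlgebra.of ℂ D.G g • y) i = D.rhoAt i g (ψ y i))
    (J : ℂ ⊗[fieldOfValues E D.μ] D.Ω →ₗ[ℂ] T.H) (hJinj : Function.Injective J)
    (hJ : ∀ (g : D.G) (x : ℂ ⊗[fieldOfValues E D.μ] D.Ω),
      J ((D.rhoΩ g).baseChange ℂ x) = MonoidAlgebra.of ℂ D.G g • J x)
    (Dμ : D.Obj)
    (hpin : ∀ (K : Lvl) (φ : D.HomK (Kof K) Dμ),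
      res K (J ((1 : ℂ) ⊗ₜ[fieldOfValues E D.μ] D.res (Kof K) Dμ φ)) ∈ cmCl K μ) :
    ∃ g : (⨁ a : T.Adm μ, T.Ω μ a) →ₗ[MonoidAlgebra ℂ D.G] T.H, Function.Injective g ∧
      ∃ K₀ : Lvl, ∀ K ≤ K₀, ∀ y, g y ∈ fixedBy (Kof K) T.H → res K (g y) ∈ Submodule.span ℂ (cmCl K μ) := by
  obtain ⟨Φ, hΦ, -, -, -⟩ := id hLiu
  -- the `ℂ`-linear composite `g₀ := J ∘ Φ⁻¹ ∘ ψ`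
  let g₀ : (⨁ a : T.Adm μ, T.Ω μ a) →ₗ[ℂ] T.H := J ∘ₗ (Φ.symm.toLinearMap ∘ₗ ψ.toLinearMap)
  have hg₀ : ∀ y, g₀ y = J (Φ.symm (ψ y)) := fun _ => rfl
  -- `Φ⁻¹ ∘ ψ` is `G`-equivariant
  have hsymm : ∀ (g : D.G) (y : ⨁ a : T.Adm μ, T.Ω μ a),
      (D.rhoΩ g).baseChange ℂ (Φ.symm (ψ y)) = Φ.symm (ψ (MonoidAlgebra.of ℂ D.G g • y)) := by
    intro g y
    apply Φ.injective
    rw [LinearEquiv.apply_symm_apply]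
    refine DFinsupp.ext fun i => ?_
    rw [hΦ, LinearEquiv.apply_symm_apply, hψ]
  have hcomm : ∀ (g : D.G) (y : ⨁ a : T.Adm μ, T.Ω μ a),
      g₀ (MonoidAlgebra.single g (1 : ℂ) • y) = MonoidAlgebra.single g (1 : ℂ) • g₀ y := by
    intro g y
    rw [← MonoidAlgebra.of_apply, hg₀, hg₀, ← hsymm, hJ]
  let g : (⨁ a : T.Adm μ, T.Ω μ a) →ₗ[MonoidAlgebra ℂ D.G] T.H := MonoidAlgebra.equivariantOfLinearOfComm g₀ hcomm
  have hg : ∀ y, g y = J (Φ.symm (ψ y)) := fun _ => rfl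
  -- the generation step, by pin-3's as-printed lemma at `act g x := of g • x`
  obtain ⟨K₀, hK₀⟩ := Thm418Data.resW_mem_span_of_fixed_of_thm418AsPrinted_act hLiu Dμ Kof hmono hoc hcof
    (fun (g : D.G) (x : T.H) => MonoidAlgebra.of ℂ D.G g • x) res (fun K => cmCl K μ) J hJ hJinj hpin
  refine ⟨g, hJinj.comp (Φ.symm.injective.comp ψ.injective), K₀, fun K hKle y hfix => ?_⟩
  rw [hg]
  exact hK₀ K hKle (Φ.symm (ψ y)) fun k hk => by rw [← hg]; exact hfix k hk

end Adapter

end LiuAlbaneseModuleDatum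

end HodgeCM.Literature.Theta

end
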